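import Summits.Langlands.Langlands.Theses.ParityBlindBianchi
import Summits.Langlands.Langlands.Theorems.ArtinWeightRealisationLevel.Negative.ZeroSector
import Summits.Langlands.Langlands.Theorems.ArtinWeightRealisationLevel.Negative.PlacesOverP
import Summits.Langlands.Langlands.Theorems.ParityBlindBianchiArtinWeightRealisationLevelSharedOfLevel

/-!
# Disproof of `ArtinWeightRealisationEven` (R″, crux stmt-Langlands-16619, route ParityBlindBianchi) — findings

Crux disprover `cdisprove-stmt-Langlands-16619` (refuter-cdisprove-stmt-Langlands-16619-0), cycle 1,
2026-08-17.  Lean work file; prose only in docstrings; EVERY theorem below is sorry-free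
(`lean check` rc 0, 0 sorries).  Builds on (and imports) the parent crux's landed negatives
`Theorems/ArtinWeightRealisationLevel/Negative/{ZeroSector,PlacesOverP}.lean` (R′ = stmt-15111,
disprover cdisprove-stmt-Langlands-15111, workfile `Cruxes/ArtinWeightRealisationLevel/Disproof.lean`)
and the R′ lead's `isHeckePoint_comp` (`Theorems/…LevelSharedOfLevel.lean`).  LANDED from this file
(`Theorems/ArtinWeightRealisationEven/Negative/`): `FiniteRangeOfModel.lean` (p145419, ACCEPTED),
`PlacesOverPEven.lean` (p146351, ACCEPTED), `ZeroSectorEven.lean` (p147778).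

## VERDICT (cycle 1): NO KILL — none is possible short of a counterexample to Artin reciprocity
for `GL₂` over an imaginary quadratic field (equivalently, modulo print, to even icosahedral strong
Artin over `ℚ`).

READ-BACK (W.lean rc 0; `crux_iff` below is `Iff.rfl` against the route decl).  R″ = for every prime
`p`, `ι : ℚ̄_p ≃+* ℂ`, `ρ : Γ_ℚ →ₜ* GL₂(ℂ)` irreducible with projective image `≃* A₅` (`IsIcosahedral`)
and `det ρ(c) = 1` at every complex conjugation (`IsEven`; `IsComplexConjugation` is Serre's notion,
`c ≠ 1` forced), every imaginary quadratic `K` (`IsTotallyComplex ∧ finrank ℚ K = 2`; NO splitting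
condition on `p`), every `σ : Γ_K →ₜ* GL₂(ℚ̄_p)` with `ι(σ(g)_{ij}) = ρ(g|_{ℚ̄})_{ij}` (`IsModel`, along
the tree's fixed `absGaloisRestrict ℚ K`), finite image, irreducible, every `S₀ : Finset ℕ` with
`p ∈ S₀`, `0 ∉ S₀`: `Hyp K p σ S₀ → Concl K p ι σ S₀`, where `Hyp` = E2′'s conclusion package with
`2 ↦ p` (open `U ≤ GL₂(𝒪̂_K)` saturated at the bad places, unit uniformisers, an `𝒪_{ℚ̄_p}`-valued
point `T_{v,i} ↦ a_{v,i}` of the big Hecke algebra of the `p`-power tower — `IsHeckePoint`: for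
every `t` a `k`-algebra map `𝕋 → 𝒪/p^t` factoring through finitely many `H^i(X_{U(s)}, 𝒪/p^{t'})`
— and Hansen association `charpoly σ(Frob_v⁻¹) = X² − a_{v,1}X + q_v a_{v,2}` with `σ` UNRAMIFIED at
every good `v`) and `Concl` = a genuine cuspidal `π` of `GL₂(𝔸_K)` (`CuspidalAutomorphicRepData`:
stable spaces of cusp forms `W' < W`, irreducible quotient — no junk inhabitant, cf. the `n = 0`
witness of `OrdinaryPrimeTransportRankinSelbergPoleCountRefutation`, impossible at `n = 2`) with
`SatakeFrobCompatibleAt ι π σ w` (`∃ α`, `HasSatakeParamAt`, `σ` unramified at `w`,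
`charpoly σ(Frob_w) = ∏(X − ι⁻¹(α_j⁻¹))`) at EVERY good `w`.  No junk operator (`/`, ℕ-`-`, `tsum`,
`sSup`; `0⁻¹` only inside `arithFrobPolyOfSatake` at `α ∋ 0`, excluded by `det ≠ 0`), no silent
`[Fintype]`, universes `Type 0`, quantifier order = the informal text.

WHY IT RESISTS (numbers, not adjectives).
(1) SANDWICH, kernel-checked against the live decl by earlier seats: `R′ → R″` (p125089),
`Target + AC III.4.2(a) + JL → R″` (p125574, the Hecke package used ONLY through
`IsHeckeAssociatedAt.isUnramifiedAt`), and `E1″ → E2′ → R″ → D″ → Target` (`closes`).  Hence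
`¬R″ → ¬(EvenIcosahedralStrongArtin ∧ baseChange ∧ JL)`: a kill of R″ is a disproof of even
icosahedral strong Artin over `ℚ` (or of a printed theorem).  Nothing of the kind is in print
(Calegari 2023 §12: not one even `SL₂(𝔽₅)`-type `ρ` is known automorphic, none is known
non-automorphic; non-automorphy is not a provable property in any known framework).
(2) NO JUNK SECTOR LEFT.  The three junk handles of the parent crux are typed away or idle:
`0 ∈ S₀` (no good place, empty Hecke family, `Hyp` provable, conclusion = bare existence of Bianchi
cusp forms) is excluded by `0 ∉ S₀` — §a1 shows this binder removes EXACTLY that sector; `p ∈ S₀`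
is decoration (§a2, transport to `insert p S₀`); places over `p` can never be good under
association (`PlacesOverP`).  With `0 ∉ S₀` there are infinitely many good places, the Hecke family
is non-empty, and a Hecke point associated with an IRREDUCIBLE `σ` is genuine `p`-adic automorphic
content (parent Disproof §a4: the automorphic-free points are the degree-`0` Eisenstein systems
`((q_v+1)ψ(ϖ_v), ψ(ϖ_v)²)` ↔ `ψ ⊕ ψε⁻¹`, reducible; Farrell classes serve only bounded `t`).
(3) THE NEW BINDERS CARRY NO JUNK AND NO HANDLE: `IsEven` is satisfiable and excludes only the
in-print odd sector (§a3: `WithoutEven ↔ R″ ∧ OddSector`); `IsModel` is the only coupling of `σ` to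
`ρ` (§a4: without it R″ is the whole repaired parent crux, given one even icosahedral `ρ`);
`Finite σ.range` is REDUNDANT (§a5, proved from `IsModel` + finiteness of Artin images);
`σ.IsIrreducible` is redundant on paper (`ρ` irreducible + `A₅` has no subgroup of index `2` ⇒
`ρ|_K` irreducible — Clifford; not formalised here); `IsIcosahedral`/irreducibility of `ρ` act on `σ`
only through `IsModel`.
(4) NEITHER SIDE IS CONSTRUCTIBLE IN LEAN: a witness of `Hyp` for an irreducible `σ` needs E2′-type
`R = 𝕋` input; `¬Concl` needs the structure of the cuspidal spectrum of `GL₂/K`; so even the natural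
strengthenings (§c) are refutable on paper only.  Consequently there is NO `_false_without_<H>`
theorem for ANY binder `H` of R″: every mutation is implied either by strong Artin over `K` (true,
open) or by the existence of Bianchi cusp forms (true, named fact
`nonempty_cuspidalAutomorphicRepData_two`).

## INDEX of checked content

* §0 `Hyp`, `Concl`, `IsIcosahedral`, `IsEven`, `IsModel`; `crux_iff` (definitional read-back).
* §a LOAD-BEARING ANALYSIS (what each binder is worth; all kernel-checked):
  - a1 `0 ∉ S₀`: **`WithoutZeroNotMem ↔ R″ ∧ ZeroSectorEven`** (`withoutZeroNotMem_iff`,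
    `zeroSectorEven_of_withoutZeroNotMem`) — load-bearing for TYPING only; the rev-10 repair is
    minimal and sufficient.
  - a2 `p ∈ S₀`: **`WithoutMemS₀ ↔ R″`** (`hyp_insert` via `isHeckePoint_comp`, `withoutMemS₀_iff`);
    the opposite mutation "`S₀` avoids `p`" is VACUOUS (`concl_of_hyp_of_forall_good`).
  - a3 evenness: **`WithoutEven ↔ R″ ∧ OddSector`** (`withoutEven_iff`); `OddSector` is in print
    (KW 2009 + Kisin 2009 + Langlands 1980 base change; tree `…LevelOddBaseChangeSector.lean`), so
    evenness is not load-bearing for truth — it isolates the sector with NO in-print content.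
  - a4 model relation: **`WithoutModel ↔ ((∃ even icosahedral ρ) → LevelRepaired)`**
    (`withoutModel_iff`) and `LevelRepaired → R″` (`crux_of_levelRepaired`): the model relation is
    load-bearing for SCOPE (it is what makes R″ narrower than R′); no handle.
  - a5 `Finite σ.range`: **REDUNDANT** — `finite_range_of_isModel`, `withoutFinite_iff :
    WithoutFinite ↔ R″`.
  - (paper) `σ.IsIrreducible` redundant; `IsTotallyComplex`/`finrank = 2` dropped = R″ over all
    number fields, still implied by strong Artin over `K` — no handle; `Hyp` is the ONLY handle and
    its only cheap consequence is unramifiedness of `σ` off `S₀`.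
* §b TIGHTNESS OF USE (planner-facing): `closes` consumes R″ ONLY at `p = 2` and for `2`-SPLIT `K`
  — **`closes_of_splitTwo`** re-proves the deciding theorem verbatim with
  `ArtinWeightRealisationEvenSplitTwo` (R″ at `p = 2`, `K` with two distinct places over `2`) in
  place of R″, and `splitTwo_of_crux : R″ → SplitTwo`.  The `∀ p` / all-`K` generality is unconsumed
  overshoot; moreover for `K` with `p` inert or ramified (`K_v ≠ ℚ_p`) the route's stated evasion of
  `Literature.Barriers.Langlands.ModPLanglandsGL2BeyondQp` ("every field in the chain has 2 split,
  `K_v = ℚ₂`") does NOT cover the crux as typed.  RECOMMENDATION (free, no proof obligation changes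
  for `closes`): restate R″ as `SplitTwo` (add `p = 2` and the two-places-over-2 hypothesis of E2′),
  or keep R″ and record that its extra instances are not wanted.
* §c NATURAL STRENGTHENINGS (paper only; objects not constructible): conclusion at EVERY place —
  false wherever `σ` ramifies (`SatakeFrobCompatibleAt` contains `IsUnramifiedAt`; Minkowski forces
  `ρ` to ramify, but `ρ|_K` may absorb order-`2` inertia at primes ramified in `K`, so even this is
  instance-dependent); drop `IsIrreducible` of `σ` together with `IsModel` — Eisenstein points
  `ψ₁ ⊕ χ₂` of `Spf 𝕋` with no cuspidal `π` (Jacquet–Shalika), parent Disproof §c; drop `Finite`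
  together with `IsModel` — cohomological Bianchi eigenclasses, `m = 1` normalisation fails, parent §c.
* §d TARGETS (pre-line; `stuck_stubs = []`, no line picked): the idea card's shipped first lemma
  `AdjointPinning.QuadraticTwistPinning` (SketchIdeator2.lean) RE-ADMITS THE ZERO SECTOR (`∀ S₀` with
  no `0 ∉ S₀`): **`false_of_quadraticTwistPinning`** — at `S₀ = {0}`, `r = 1` it forces `σ` scalar,
  contradicting projective image `A₅`; so it is false modulo the existence of one icosahedral `σ`
  (`not_quadraticTwistPinning_of_exists_icosahedral`).  Repair: add `(0 : ℕ) ∉ S₀` or state the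
  compatibility place-free; the repaired lemma is paper-plausible.  (Idea grading is the triage
  panel's business; this is a typing bug report.)
* §e NEAR-MISSES: none (no sorried theorem).

Barriers: `Literature.Barriers.Langlands.NonRegularWeightBarrier` applies verbatim (the item IS the
singular-weight wall over a field with a complex place; ideator-2's NegativeNotes sharpen it for the
EVEN sector: no coherent Shimura host on any `U(N)_{K/ℚ}`); `ModPLanglandsGL2BeyondQp` re-engaged by
the unconsumed non-split instances (§b).  Negatives index (Langlands, 3 entries: SplitPrimeInduction
deinduction, OrdinaryPrimeTransport `n = 0`, K3KugaSatake anchor): none bears on R″.  Literature this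
cycle: local searchd unreachable (connection reset — search-degraded), S2 sweep "Artin representations
p-adic automorphic forms imaginary quadratic classicality weight one Bianchi" (10 hits: Barrera–Williams
Bianchi families, Betina–Williams p-irregular, Kilford weight-1 JL, Darmon–Lauder–Rotger — all on the
odd/base-change or analytic side; 0 applicable), plus the grounder's logged sweep of 2026-08-16 (0
applicable; Calegari–Mazur 2008 is characteristic-0 nearly-ordinary isolation, not torsion occurrence).
-/

noncomputable section

set_option linter.dupNamespace false

open scoped NumberField

namespace Summit.Langlands.Langlands.Cruxes.ArtinWeightRealisationEven.Disproof

open Literature.NumberTheory.Automorphic Literature.NumberTheory.GaloisRepresentations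
  IsDedekindDomain
open Summit.Langlands.Langlands.Theses.ParityBlindBianchi
open Summit.Langlands.Langlands.Theorems.ArtinWeightRealisationLevel.Negative
open Summit.Langlands.Langlands.Theorems.ArtinWeightRealisationLevel (isHeckePoint_comp)

/-! ## §0 The hypothesis package, the conclusion, the new binders; read-back -/

/-- The hypothesis package of R″ at `(K, p, σ, S₀)` ("`σ` is `p`-adically automorphic of tame level
`S₀`"), verbatim: the conclusion package of E2′ with `2 ↦ p`; identical to R′'s package. -/
def Hyp (K : Type) [Field K] [NumberField K] (p : ℕ) [Fact p.Prime]
    (σ : FramedGaloisRep K (PadicAlgCl p) 2) (S₀ : Finset ℕ) : Prop :=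
  ∃ (U : Subgroup (GL (Fin 2) (IsDedekindDomain.FiniteAdeleRing (NumberField.RingOfIntegers K) K))) (ϖ : ∀ v : IsDedekindDomain.HeightOneSpectrum (NumberField.RingOfIntegers K), (v.adicCompletion K)ˣ) (a : {v : IsDedekindDomain.HeightOneSpectrum (NumberField.RingOfIntegers K) // ∀ ℓ ∈ S₀, ((ℓ : ℕ) : NumberField.RingOfIntegers K) ∉ v.asIdeal} → ℕ → (Valued.v (R := PadicAlgCl p)).valuationSubring), IsOpen (U : Set (GL (Fin 2) (IsDedekindDomain.FiniteAdeleRing (NumberField.RingOfIntegers K) K))) ∧ U ≤ Literature.NumberTheory.Automorphic.glFiniteIntegralLevel 2 K ∧ (∀ g ∈ Literature.NumberTheory.Automorphic.glFiniteIntegralLevel 2 K, (∀ v : IsDedekindDomain.HeightOneSpectrum (NumberField.RingOfIntegers K), ¬ (∀ ℓ ∈ S₀, ((ℓ : ℕ) : NumberField.RingOfIntegers K) ∉ v.asIdeal) → ∀ i j : Fin 2, ((g : Matrix (Fin 2) (Fin 2) (IsDedekindDomain.FiniteAdeleRing (NumberField.RingOfIntegers K) K)) i j) v = (1 : Matrix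 (Fin 2) (Fin 2) (v.adicCompletion K)) i j) → g ∈ U) ∧ (∀ v : IsDedekindDomain.HeightOneSpectrum (NumberField.RingOfIntegers K), Valued.v ((ϖ v : (v.adicCompletion K)ˣ) : v.adicCompletion K) = WithZero.exp (-1 : ℤ)) ∧ Literature.NumberTheory.Automorphic.IsHeckePoint (Matrix.GeneralLinearGroup.map (n := Fin 2) (algebraMap K (IsDedekindDomain.FiniteAdeleRing (NumberField.RingOfIntegers K) K))) (Literature.NumberTheory.Automorphic.LevelTower.ofSeq U (fun r : ℕ => (Literature.NumberTheory.Automorphic.principalCongruenceLevel 2 K (Ideal.span {((p : ℕ) : NumberField.RingOfIntegers K)} ^ r)).map (Literature.NumberTheory.Automorphic.GLn.sndHom 2 K))) ((p : ℕ) : (Valued.v (R := PadicAlgCl p)).valuationSubring) (fun j : {v : IsDedekindDomain.HeightOneSpectrum (NumberField.RingOfIntegers K) // ∀ ℓ ∈ S₀, ((ℓ : ℕ) : NumberField.RingOfIntegers K) ∉ v.asIdeal} × Fin 2 => Literature.NumberTheory.Automorphic.GLn.sndHom 2 K (Literature.NumberTheory.Automorphic.heckeDiagAt 2 K j.1.1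 (ϖ j.1.1) (j.2.val + 1))) (fun j => a j.1 (j.2.val + 1)) ∧ ∀ (v : IsDedekindDomain.HeightOneSpectrum (NumberField.RingOfIntegers K)) (hv : ∀ ℓ ∈ S₀, ((ℓ : ℕ) : NumberField.RingOfIntegers K) ∉ v.asIdeal), σ.IsHeckeAssociatedAt v (fun i : ℕ => if i = 0 then (1 : PadicAlgCl p) else ((a ⟨v, hv⟩ i : (Valued.v (R := PadicAlgCl p)).valuationSubring) : PadicAlgCl p))

/-- The conclusion of R″ at `(K, p, ι, σ, S₀)`, verbatim: a cuspidal `π` of `GL₂(𝔸_K)`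
Satake–Frobenius compatible with `σ` at EVERY good place. -/
def Concl (K : Type) [Field K] [NumberField K] (p : ℕ) [Fact p.Prime] (ι : PadicAlgCl p ≃+* ℂ)
    (σ : FramedGaloisRep K (PadicAlgCl p) 2) (S₀ : Finset ℕ) : Prop :=
  ∃ (hcpt : Literature.NumberTheory.Automorphic.isCompact_glFiniteIntegralLevel 2 K) (π : Literature.NumberTheory.Automorphic.CuspidalAutomorphicRepData 2 K hcpt), ∀ w : IsDedekindDomain.HeightOneSpectrum (NumberField.RingOfIntegers K), (∀ ℓ ∈ S₀, ((ℓ : ℕ) : NumberField.RingOfIntegers K) ∉ w.asIdeal) → SatakeFrobCompatibleAt ι π.1 σ w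

/-- NEW BINDER 1 of R″ (vs R′): `ρ` has projective image `A₅`. -/
def IsIcosahedral (ρ : FramedGaloisRep ℚ ℂ 2) : Prop :=
  Nonempty ((Matrix.ProjGenLinGroup.mk.comp ρ.toMonoidHom).range ≃* alternatingGroup (Fin 5))

/-- NEW BINDER 2 of R″: `ρ` is EVEN (`det ρ(c) = 1` at every complex conjugation). -/
def IsEven (ρ : FramedGaloisRep ℚ ℂ 2) : Prop :=
  ∀ (φ : ℚ →+* ℝ) (c : Field.absoluteGaloisGroup ℚ), IsComplexConjugation φ c →
    Matrix.GeneralLinearGroup.det (ρ c) = 1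

/-- NEW BINDER 3 of R″: `σ` is the entrywise `ι`-model of `ρ|_{Γ_K}`. -/
def IsModel {p : ℕ} [Fact p.Prime] (ι : PadicAlgCl p ≃+* ℂ) (ρ : FramedGaloisRep ℚ ℂ 2)
    (K : Type) [Field K] [NumberField K] (σ : FramedGaloisRep K (PadicAlgCl p) 2) : Prop :=
  ∀ (g : Field.absoluteGaloisGroup K) (i j : Fin 2),
    ι ((σ g).val i j) = ((FramedGaloisRep.restrictField K ρ) g).val i j

/-- R″ unfolded through `Hyp`/`Concl`/the three new binders (definitional check against the route
file). -/
theorem crux_iff : ArtinWeightRealisationEven ↔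
    ∀ (p : ℕ) [Fact p.Prime] (ι : PadicAlgCl p ≃+* ℂ) (ρ : FramedGaloisRep ℚ ℂ 2),
      ρ.toGaloisRep.IsIrreducible → IsIcosahedral ρ → IsEven ρ →
        ∀ (K : Type) [Field K] [NumberField K], NumberField.IsTotallyComplex K → Module.finrank ℚ K = 2 →
          ∀ (σ : FramedGaloisRep K (PadicAlgCl p) 2), IsModel ι ρ K σ →
            Finite σ.toMonoidHom.range → σ.toGaloisRep.IsIrreducible →
              ∀ S₀ : Finset ℕ, p ∈ S₀ → (0 : ℕ) ∉ S₀ → Hyp K p σ S₀ → Concl K p ι σ S₀ :=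
  Iff.rfl


/-! ## §a LOAD-BEARING ANALYSIS of the binders of R″

Conventions: `…Without<H>` is R″ with the hypothesis `H` deleted, written through `Hyp`/`Concl`.
No `_false_without_<H>` theorem exists for ANY `H` (see the docblock: every mutation is implied by
strong Artin over `K` or by the existence of Bianchi cusp forms, both TRUE statements); what CAN be
kernel-checked is what each binder is worth. -/

/-! ### §a1 `0 ∉ S₀` — load-bearing for TYPING only: without it the junk zero sector returns -/

/-- R″ with the binder `(0 : ℕ) ∉ S₀` deleted. -/
def ArtinWeightRealisationEvenWithoutZeroNotMem : Prop :=
  ∀ (p : ℕ) [Fact p.Prime] (ι : PadicAlgCl p ≃+* ℂ) (ρ : FramedGaloisRep ℚ ℂ 2),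
    ρ.toGaloisRep.IsIrreducible → IsIcosahedral ρ → IsEven ρ →
      ∀ (K : Type) [Field K] [NumberField K], NumberField.IsTotallyComplex K → Module.finrank ℚ K = 2 →
        ∀ (σ : FramedGaloisRep K (PadicAlgCl p) 2), IsModel ι ρ K σ →
          Finite σ.toMonoidHom.range → σ.toGaloisRep.IsIrreducible →
            ∀ S₀ : Finset ℕ, p ∈ S₀ → Hyp K p σ S₀ → Concl K p ι σ S₀

/-- **The zero sector of R″** (foreign to the mechanism, true, not provable in the tree): every
imaginary quadratic `K` carrying the `ι`-model of `ρ|_K` for SOME even icosahedral `ρ` has a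
cuspidal automorphic representation of `GL₂(𝔸_K)` (cf. the named fact
`nonempty_cuspidalAutomorphicRepData_two`, Gelbart 1975 Thm. 7.11). -/
def ZeroSectorEven : Prop :=
  ∀ (p : ℕ) [Fact p.Prime] (ι : PadicAlgCl p ≃+* ℂ) (ρ : FramedGaloisRep ℚ ℂ 2),
    ρ.toGaloisRep.IsIrreducible → IsIcosahedral ρ → IsEven ρ →
      ∀ (K : Type) [Field K] [NumberField K], NumberField.IsTotallyComplex K → Module.finrank ℚ K = 2 →
        ∀ (σ : FramedGaloisRep K (PadicAlgCl p) 2), IsModel ι ρ K σ →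
          Finite σ.toMonoidHom.range → σ.toGaloisRep.IsIrreducible →
            ∃ hcpt : isCompact_glFiniteIntegralLevel 2 K, Nonempty (CuspidalAutomorphicRepData 2 K hcpt)

/-- **Dropping `0 ∉ S₀` makes R″ prove the zero sector**: feed the mutated crux the bad set
`{0, p}` and the PROVABLE package of the zero sector (`hyp_of_zero_mem`, landed
`Theorems/ArtinWeightRealisationLevel/Negative/ZeroSector.lean`: empty Hecke family, constant class
in `H⁰`); no place is good, so the conclusion is `∃ hcpt π, True`.  [folklore] -/
theorem zeroSectorEven_of_withoutZeroNotMem (h : ArtinWeightRealisationEvenWithoutZeroNotMem) :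
    ZeroSectorEven := by
  intro p _ ι ρ hirr hA5 heven K _ _ htc hdeg σ hmodel hfin hirrσ
  obtain ⟨hcpt, π, -⟩ := h p ι ρ hirr hA5 heven K htc hdeg σ hmodel hfin hirrσ {0, p} (by simp)
    (hyp_of_zero_mem K p σ {0, p} (by simp))
  exact ⟨hcpt, ⟨π⟩⟩

/-- **`WithoutZeroNotMem ↔ R″ ∧ ZeroSectorEven`** (kernel-checked split): the binder `0 ∉ S₀`
removes exactly the junk zero sector and nothing else — the planner's rev-10 repair of R′ is
confirmed minimal and sufficient on this binder. [folklore] -/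
theorem withoutZeroNotMem_iff :
    ArtinWeightRealisationEvenWithoutZeroNotMem ↔ ArtinWeightRealisationEven ∧ ZeroSectorEven := by
  refine ⟨fun h => ⟨fun p _ ι ρ hirr hA5 heven K _ _ htc hdeg σ hmodel hfin hirrσ S₀ hp _ hyp =>
      h p ι ρ hirr hA5 heven K htc hdeg σ hmodel hfin hirrσ S₀ hp hyp,
    zeroSectorEven_of_withoutZeroNotMem h⟩, fun ⟨hR, hZ⟩ => ?_⟩
  intro p _ ι ρ hirr hA5 heven K _ _ htc hdeg σ hmodel hfin hirrσ S₀ hp hyp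
  by_cases h0 : (0 : ℕ) ∈ S₀
  · exact instance_of_zero_mem_of_cuspForms K p ι σ S₀ h0
      (hZ p ι ρ hirr hA5 heven K htc hdeg σ hmodel hfin hirrσ)
  · exact hR p ι ρ hirr hA5 heven K htc hdeg σ hmodel hfin hirrσ S₀ hp h0 hyp

/-! ### §a2 `p ∈ S₀` — idle (decoration): `WithoutMemS₀ ↔ R″` -/

/-- **Transport of the package to `insert p S₀`.**  Under `Hyp K p σ S₀` with `σ` of finite image
the places over `p` are already bad (`places_over_p_bad_of_assoc`, landed `…/Negative/PlacesOverP.lean`: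
`det σ(Frob⁻¹) = q_v a_{v,2}` has norm `1` on the left, `< 1` on the right), so `S₀` and
`insert p S₀` have the same good places; the level condition and the association are inherited and
the Hecke point PULLS BACK along the inclusion of index types (`isHeckePoint_comp`, landed
`…SharedOfLevel.lean`). [folklore] -/
theorem hyp_insert {K : Type} [Field K] [NumberField K] {p : ℕ} [Fact p.Prime]
    {σ : FramedGaloisRep K (PadicAlgCl p) 2} (hfin : Finite σ.toMonoidHom.range) {S₀ : Finset ℕ}
    (h : Hyp K p σ S₀) : Hyp K p σ (insert p S₀) := by
  obtain ⟨U, ϖ, a, hopen, hle, hlev, hϖ, hpt, hassoc⟩ := h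
  have hgood : ∀ v : HeightOneSpectrum (𝓞 K),
      (∀ ℓ ∈ insert p S₀, ((ℓ : ℕ) : 𝓞 K) ∉ v.asIdeal) ↔ (∀ ℓ ∈ S₀, ((ℓ : ℕ) : 𝓞 K) ∉ v.asIdeal) := by
    intro v
    refine ⟨fun h ℓ hℓ => h ℓ (Finset.mem_insert_of_mem hℓ), fun h ℓ hℓ => ?_⟩
    rcases Finset.mem_insert.1 hℓ with rfl | hℓ
    · intro hpv
      exact places_over_p_bad_of_assoc σ hfin S₀ a hassoc v hpv h
    · exact h ℓ hℓ
  let e : {v : HeightOneSpectrum (𝓞 K) // ∀ ℓ ∈ insert p S₀, ((ℓ : ℕ) : 𝓞 K) ∉ v.asIdeal} →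
      {v : HeightOneSpectrum (𝓞 K) // ∀ ℓ ∈ S₀, ((ℓ : ℕ) : 𝓞 K) ∉ v.asIdeal} :=
    fun v => ⟨v.1, (hgood v.1).1 v.2⟩
  let E : {v : HeightOneSpectrum (𝓞 K) // ∀ ℓ ∈ insert p S₀, ((ℓ : ℕ) : 𝓞 K) ∉ v.asIdeal} × Fin 2 →
      {v : HeightOneSpectrum (𝓞 K) // ∀ ℓ ∈ S₀, ((ℓ : ℕ) : 𝓞 K) ∉ v.asIdeal} × Fin 2 :=
    fun j => (e j.1, j.2)
  refine ⟨U, ϖ, fun v => a (e v), hopen, hle, fun g hg hgS => hlev g hg fun v hv => hgS v ?_, hϖ,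
    ?_, fun v hv => hassoc v ((hgood v).1 hv)⟩
  · exact fun h => hv ((hgood v).1 h)
  · exact isHeckePoint_comp
      (Matrix.GeneralLinearGroup.map (n := Fin 2) (algebraMap K (FiniteAdeleRing (𝓞 K) K)))
      (LevelTower.ofSeq U (fun r : ℕ =>
        (principalCongruenceLevel 2 K (Ideal.span {((p : ℕ) : 𝓞 K)} ^ r)).map (GLn.sndHom 2 K)))
      ((p : ℕ) : (Valued.v (R := PadicAlgCl p)).valuationSubring) E
      (fun j : {v : HeightOneSpectrum (𝓞 K) // ∀ ℓ ∈ S₀, ((ℓ : ℕ) : 𝓞 K) ∉ v.asIdeal} × Fin 2 =>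
        GLn.sndHom 2 K (heckeDiagAt 2 K j.1.1 (ϖ j.1.1) (j.2.val + 1)))
      (fun j => a j.1 (j.2.val + 1)) hpt

/-- R″ with the binder `p ∈ S₀` deleted. -/
def ArtinWeightRealisationEvenWithoutMemS₀ : Prop :=
  ∀ (p : ℕ) [Fact p.Prime] (ι : PadicAlgCl p ≃+* ℂ) (ρ : FramedGaloisRep ℚ ℂ 2),
    ρ.toGaloisRep.IsIrreducible → IsIcosahedral ρ → IsEven ρ →
      ∀ (K : Type) [Field K] [NumberField K], NumberField.IsTotallyComplex K → Module.finrank ℚ K = 2 →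
        ∀ (σ : FramedGaloisRep K (PadicAlgCl p) 2), IsModel ι ρ K σ →
          Finite σ.toMonoidHom.range → σ.toGaloisRep.IsIrreducible →
            ∀ S₀ : Finset ℕ, (0 : ℕ) ∉ S₀ → Hyp K p σ S₀ → Concl K p ι σ S₀

/-- **`p ∈ S₀` is removable: `WithoutMemS₀ ↔ R″`** — the binder is neither a handle for the
disprover nor information for the prover (transport to `insert p S₀`, which still avoids `0` since
`p ≠ 0`). [folklore] -/
theorem withoutMemS₀_iff : ArtinWeightRealisationEvenWithoutMemS₀ ↔ ArtinWeightRealisationEven := by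
  refine ⟨fun h p _ ι ρ hirr hA5 heven K _ _ htc hdeg σ hmodel hfin hirrσ S₀ _ h0 hyp =>
      h p ι ρ hirr hA5 heven K htc hdeg σ hmodel hfin hirrσ S₀ h0 hyp,
    fun h p _ ι ρ hirr hA5 heven K _ _ htc hdeg σ hmodel hfin hirrσ S₀ h0 hyp => ?_⟩
  have h0' : (0 : ℕ) ∉ insert p S₀ := by
    rw [Finset.mem_insert, not_or]
    exact ⟨(Fact.out : p.Prime).ne_zero.symm, h0⟩
  obtain ⟨hcpt, π, hπ⟩ := h p ι ρ hirr hA5 heven K htc hdeg σ hmodel hfin hirrσ (insert p S₀)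
    (Finset.mem_insert_self p S₀) h0' (hyp_insert hfin hyp)
  refine ⟨hcpt, π, fun w hw => hπ w fun ℓ hℓ => ?_⟩
  rcases Finset.mem_insert.1 hℓ with rfl | hℓ
  · intro hpw
    obtain ⟨U, ϖ, a, -, -, -, -, -, hassoc⟩ := hyp
    exact places_over_p_bad_of_assoc σ hfin S₀ a hassoc w hpw hw
  · exact hw ℓ hℓ

/-- **The opposite mutation (`S₀` avoiding `p`, e.g. `S₀ = ∅`) is VACUOUS, not false**: if every
place over `p` is good the association clause is unsatisfiable (`assoc_false_of_forall_good`). -/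
theorem concl_of_hyp_of_forall_good {K : Type} [Field K] [NumberField K] {p : ℕ} [Fact p.Prime]
    (ι : PadicAlgCl p ≃+* ℂ) {σ : FramedGaloisRep K (PadicAlgCl p) 2}
    (hfin : Finite σ.toMonoidHom.range) {S₀ : Finset ℕ}
    (hS : ∀ v : HeightOneSpectrum (𝓞 K), ((p : ℕ) : 𝓞 K) ∈ v.asIdeal →
      ∀ ℓ ∈ S₀, ((ℓ : ℕ) : 𝓞 K) ∉ v.asIdeal)
    (h : Hyp K p σ S₀) : Concl K p ι σ S₀ := by
  obtain ⟨U, ϖ, a, -, -, -, -, -, hassoc⟩ := h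
  exact (assoc_false_of_forall_good σ hfin S₀ hS a hassoc).elim

/-! ### §a3 Evenness — narrows the sector, not load-bearing for truth: `WithoutEven ↔ R″ ∧ OddSector` -/

/-- R″ with the evenness binder deleted (all parities: the "icosahedral realisation" statement). -/
def ArtinWeightRealisationEvenWithoutEven : Prop :=
  ∀ (p : ℕ) [Fact p.Prime] (ι : PadicAlgCl p ≃+* ℂ) (ρ : FramedGaloisRep ℚ ℂ 2),
    ρ.toGaloisRep.IsIrreducible → IsIcosahedral ρ →
      ∀ (K : Type) [Field K] [NumberField K], NumberField.IsTotallyComplex K → Module.finrank ℚ K = 2 →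
        ∀ (σ : FramedGaloisRep K (PadicAlgCl p) 2), IsModel ι ρ K σ →
          Finite σ.toMonoidHom.range → σ.toGaloisRep.IsIrreducible →
            ∀ S₀ : Finset ℕ, p ∈ S₀ → (0 : ℕ) ∉ S₀ → Hyp K p σ S₀ → Concl K p ι σ S₀

/-- **The ODD sector** excluded by evenness: the same statement for `ρ` NOT even (some complex
conjugation has `det ρ(c) ≠ 1`, i.e. `= −1`).  In print and not attackable: an odd irreducible
icosahedral `ρ` is modular of weight one (Khare–Wintenberger 2009 + Kisin 2009), `ρ|_K` is
automorphic by quadratic base change (Langlands 1980), and the conclusion of R″ then holds at every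
unramified place with no use of the Hecke package beyond `IsHeckeAssociatedAt.isUnramifiedAt` (tree:
`Theorems/ParityBlindBianchiArtinWeightRealisationLevelOddBaseChangeSector.lean`). -/
def OddSector : Prop :=
  ∀ (p : ℕ) [Fact p.Prime] (ι : PadicAlgCl p ≃+* ℂ) (ρ : FramedGaloisRep ℚ ℂ 2),
    ρ.toGaloisRep.IsIrreducible → IsIcosahedral ρ →
      (∃ (φ : ℚ →+* ℝ) (c : Field.absoluteGaloisGroup ℚ), IsComplexConjugation φ c ∧
        Matrix.GeneralLinearGroup.det (ρ c) ≠ 1) →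
      ∀ (K : Type) [Field K] [NumberField K], NumberField.IsTotallyComplex K → Module.finrank ℚ K = 2 →
        ∀ (σ : FramedGaloisRep K (PadicAlgCl p) 2), IsModel ι ρ K σ →
          Finite σ.toMonoidHom.range → σ.toGaloisRep.IsIrreducible →
            ∀ S₀ : Finset ℕ, p ∈ S₀ → (0 : ℕ) ∉ S₀ → Hyp K p σ S₀ → Concl K p ι σ S₀

/-- **`WithoutEven ↔ R″ ∧ OddSector`** (excluded middle on the parity of `ρ`): evenness removes
exactly the in-print odd sector; R″ is the complement, which contains NO in-print sector. [folklore] -/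
theorem withoutEven_iff :
    ArtinWeightRealisationEvenWithoutEven ↔ ArtinWeightRealisationEven ∧ OddSector := by
  refine ⟨fun h => ⟨fun p _ ι ρ hirr hA5 _ K _ _ htc hdeg σ hmodel hfin hirrσ S₀ hp h0 hyp =>
      h p ι ρ hirr hA5 K htc hdeg σ hmodel hfin hirrσ S₀ hp h0 hyp,
    fun p _ ι ρ hirr hA5 _ K _ _ htc hdeg σ hmodel hfin hirrσ S₀ hp h0 hyp =>
      h p ι ρ hirr hA5 K htc hdeg σ hmodel hfin hirrσ S₀ hp h0 hyp⟩, fun ⟨hR, hO⟩ => ?_⟩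
  intro p _ ι ρ hirr hA5 K _ _ htc hdeg σ hmodel hfin hirrσ S₀ hp h0 hyp
  by_cases heven : IsEven ρ
  · exact hR p ι ρ hirr hA5 heven K htc hdeg σ hmodel hfin hirrσ S₀ hp h0 hyp
  · have hodd : ∃ (φ : ℚ →+* ℝ) (c : Field.absoluteGaloisGroup ℚ), IsComplexConjugation φ c ∧
        Matrix.GeneralLinearGroup.det (ρ c) ≠ 1 := by
      simpa [IsEven] using heven
    exact hO p ι ρ hirr hA5 hodd K htc hdeg σ hmodel hfin hirrσ S₀ hp h0 hyp

/-! ### §a4 The model relation — the ONLY coupling of `σ` to `ρ`: without it R″ collapses to repaired R′ -/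

/-- **Repaired R′** (R′ = `ArtinWeightRealisationLevel`, stmt-15111, with `0 ∉ S₀`): every finite-image
irreducible `σ` over every imaginary quadratic `K` — the parent crux, whose genuine-icosahedral
sector has no host (Cruxes/ArtinWeightRealisationLevel/SPLIT.md). -/
def LevelRepaired : Prop :=
  ∀ (K : Type) [Field K] [NumberField K], NumberField.IsTotallyComplex K → Module.finrank ℚ K = 2 →
    ∀ (p : ℕ) [Fact p.Prime] (ι : PadicAlgCl p ≃+* ℂ) (σ : FramedGaloisRep K (PadicAlgCl p) 2),
      Finite σ.toMonoidHom.range → σ.toGaloisRep.IsIrreducible →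
        ∀ S₀ : Finset ℕ, p ∈ S₀ → (0 : ℕ) ∉ S₀ → Hyp K p σ S₀ → Concl K p ι σ S₀

/-- R″ with the model relation `IsModel ι ρ K σ` deleted (`ρ` then constrains nothing). -/
def ArtinWeightRealisationEvenWithoutModel : Prop :=
  ∀ (p : ℕ) [Fact p.Prime] (ι : PadicAlgCl p ≃+* ℂ) (ρ : FramedGaloisRep ℚ ℂ 2),
    ρ.toGaloisRep.IsIrreducible → IsIcosahedral ρ → IsEven ρ →
      ∀ (K : Type) [Field K] [NumberField K], NumberField.IsTotallyComplex K → Module.finrank ℚ K = 2 →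
        ∀ (σ : FramedGaloisRep K (PadicAlgCl p) 2),
          Finite σ.toMonoidHom.range → σ.toGaloisRep.IsIrreducible →
            ∀ S₀ : Finset ℕ, p ∈ S₀ → (0 : ℕ) ∉ S₀ → Hyp K p σ S₀ → Concl K p ι σ S₀

/-- **`WithoutModel ↔ (∃ even icosahedral ρ) → LevelRepaired`**: without the model relation the
`ρ`-binders are an idle prefix and the statement is the whole parent crux R′ (repaired) — conditional
only on the existence of ONE even irreducible icosahedral `ρ : Γ_ℚ → GL₂(ℂ)` (true: Doud–Moore 2006
tabulate them; not constructible in the tree).  So the model relation is what confines R″ to the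
route's instance; it is load-bearing for SCOPE, and through it alone do `IsIcosahedral`/`IsEven`
act on `σ`. [folklore] -/
theorem withoutModel_iff :
    ArtinWeightRealisationEvenWithoutModel ↔
      ((∃ ρ : FramedGaloisRep ℚ ℂ 2, ρ.toGaloisRep.IsIrreducible ∧ IsIcosahedral ρ ∧ IsEven ρ) →
        LevelRepaired) := by
  constructor
  · rintro h ⟨ρ, hirr, hA5, heven⟩ K _ _ htc hdeg p _ ι σ hfin hirrσ S₀ hp h0 hyp
    exact h p ι ρ hirr hA5 heven K htc hdeg σ hfin hirrσ S₀ hp h0 hyp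
  · intro h p _ ι ρ hirr hA5 heven K _ _ htc hdeg σ hfin hirrσ S₀ hp h0 hyp
    exact h ⟨ρ, hirr, hA5, heven⟩ K htc hdeg p ι σ hfin hirrσ S₀ hp h0 hyp

/-- `LevelRepaired → R″` (pure specialisation; = the landed `R′ → R″`,
`Theorems/ParityBlindBianchiArtinWeightRealisationEvenOfLevel.lean`, with `0 ∉ S₀` threaded). -/
theorem crux_of_levelRepaired (h : LevelRepaired) : ArtinWeightRealisationEven :=
  fun p _ ι _ρ _ _ _ K _ _ htc hdeg σ _ hfin hirrσ S₀ hp h0 hyp =>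
    h K htc hdeg p ι σ hfin hirrσ S₀ hp h0 hyp

/-! ### §a5 `Finite σ.toMonoidHom.range` — REDUNDANT given the model relation -/

/-- **The finite-image binder on `σ` is implied by the model relation**: `ρ : Γ_ℚ →ₜ* GL₂(ℂ)` has
finite image (`finite_range_framedArtinRep`: profinite source, no small subgroups), and the matrix
of `σ g` is the entrywise `ι⁻¹`-image of the matrix of `ρ(g|_{ℚ̄})`.  Information for the prover:
the binder carries nothing beyond `IsModel`. [folklore] -/
theorem finite_range_of_isModel {p : ℕ} [Fact p.Prime] (ι : PadicAlgCl p ≃+* ℂ)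
    (ρ : FramedGaloisRep ℚ ℂ 2) (K : Type) [Field K] [NumberField K]
    (σ : FramedGaloisRep K (PadicAlgCl p) 2) (hmodel : IsModel ι ρ K σ) :
    Finite σ.toMonoidHom.range := by
  have hρ : (Set.range (ρ : Field.absoluteGaloisGroup ℚ → GL (Fin 2) ℂ)).Finite :=
    (FramedRep.finite_range_toContinuousRep_iff ρ).mp
      (ArtinRep.finite_range_holds (K := ℚ) (V := Fin 2 → ℂ) (FramedRep.toContinuousRep ρ))
  let f : GL (Fin 2) ℂ → Matrix (Fin 2) (Fin 2) (PadicAlgCl p) :=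
    fun M => (M : Matrix (Fin 2) (Fin 2) ℂ).map ι.symm
  have hval : ∀ g : Field.absoluteGaloisGroup K,
      ((σ g : GL (Fin 2) (PadicAlgCl p)) : Matrix (Fin 2) (Fin 2) (PadicAlgCl p)) =
        f (ρ (absGaloisRestrict ℚ K g)) := by
    intro g
    ext i j
    have h1 := hmodel g i j
    rw [FramedGaloisRep.restrictField_apply] at h1
    simp only [f, Matrix.map_apply]
    rw [← h1, RingEquiv.symm_apply_apply]
  have hsub : Set.range (fun g : Field.absoluteGaloisGroup K =>
      ((σ g : GL (Fin 2) (PadicAlgCl p)) : Matrix (Fin 2) (Fin 2) (PadicAlgCl p))) ⊆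
        f '' Set.range (ρ : Field.absoluteGaloisGroup ℚ → GL (Fin 2) ℂ) := by
    rintro _ ⟨g, rfl⟩
    exact ⟨ρ (absGaloisRestrict ℚ K g), ⟨_, rfl⟩, (hval g).symm⟩
  have hfinM := (hρ.image f).subset hsub
  have hrange : Set.range (fun g : Field.absoluteGaloisGroup K =>
      ((σ g : GL (Fin 2) (PadicAlgCl p)) : Matrix (Fin 2) (Fin 2) (PadicAlgCl p))) =
        Units.val '' Set.range (σ : Field.absoluteGaloisGroup K → GL (Fin 2) (PadicAlgCl p)) := by
    rw [← Set.range_comp]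
    rfl
  rw [hrange] at hfinM
  have hfinσ : (Set.range (σ : Field.absoluteGaloisGroup K → GL (Fin 2) (PadicAlgCl p))).Finite :=
    hfinM.of_finite_image Units.val_injective.injOn
  have h4 : (σ.toMonoidHom.range : Set (GL (Fin 2) (PadicAlgCl p))) = Set.range σ := by
    rw [MonoidHom.coe_range]
    rfl
  exact Set.finite_coe_iff.mpr (h4 ▸ hfinσ)

/-- R″ with the binder `Finite σ.toMonoidHom.range` deleted. -/
def ArtinWeightRealisationEvenWithoutFinite : Prop :=
  ∀ (p : ℕ) [Fact p.Prime] (ι : PadicAlgCl p ≃+* ℂ) (ρ : FramedGaloisRep ℚ ℂ 2),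
    ρ.toGaloisRep.IsIrreducible → IsIcosahedral ρ → IsEven ρ →
      ∀ (K : Type) [Field K] [NumberField K], NumberField.IsTotallyComplex K → Module.finrank ℚ K = 2 →
        ∀ (σ : FramedGaloisRep K (PadicAlgCl p) 2), IsModel ι ρ K σ → σ.toGaloisRep.IsIrreducible →
          ∀ S₀ : Finset ℕ, p ∈ S₀ → (0 : ℕ) ∉ S₀ → Hyp K p σ S₀ → Concl K p ι σ S₀

/-- **`WithoutFinite ↔ R″`**: the finite-image binder is redundant. [folklore] -/
theorem withoutFinite_iff : ArtinWeightRealisationEvenWithoutFinite ↔ ArtinWeightRealisationEven :=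
  ⟨fun h p _ ι ρ hirr hA5 heven K _ _ htc hdeg σ hmodel _ hirrσ S₀ hp h0 hyp =>
      h p ι ρ hirr hA5 heven K htc hdeg σ hmodel hirrσ S₀ hp h0 hyp,
    fun h p _ ι ρ hirr hA5 heven K _ _ htc hdeg σ hmodel hirrσ S₀ hp h0 hyp =>
      h p ι ρ hirr hA5 heven K htc hdeg σ hmodel (finite_range_of_isModel ι ρ K σ hmodel) hirrσ
        S₀ hp h0 hyp⟩

/-! ## §b TIGHTNESS of the route's use: `closes` consumes R″ only at `p = 2` and for `2`-SPLIT `K` -/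

/-- **R″ at `p = 2` for `2`-split `K` only** — the instance the deciding theorem actually consumes
(`closes` l. 650 of the route file instantiates `hR 2 ι ρ … K …` with `K` carrying E1″/E2′'s
splitting hypothesis).  R″ as typed is STRICTLY MORE GENERAL: every prime `p`, and every imaginary
quadratic `K` — including `K` with `p` inert or ramified, where `K_v ≠ ℚ_p` and the route's claimed
evasion of `Literature.Barriers.Langlands.ModPLanglandsGL2BeyondQp` ("every field in the chain has 2
split, `K_v = ℚ₂`") does not apply to the crux as typed. -/
def ArtinWeightRealisationEvenSplitTwo : Prop :=
  ∀ (ι : PadicAlgCl 2 ≃+* ℂ) (ρ : FramedGaloisRep ℚ ℂ 2),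
    ρ.toGaloisRep.IsIrreducible → IsIcosahedral ρ → IsEven ρ →
      ∀ (K : Type) [Field K] [NumberField K], NumberField.IsTotallyComplex K → Module.finrank ℚ K = 2 →
        (∃ v w : HeightOneSpectrum (𝓞 K), v ≠ w ∧ ((2 : ℕ) : 𝓞 K) ∈ v.asIdeal ∧ ((2 : ℕ) : 𝓞 K) ∈ w.asIdeal) →
        ∀ (σ : FramedGaloisRep K (PadicAlgCl 2) 2), IsModel ι ρ K σ →
          Finite σ.toMonoidHom.range → σ.toGaloisRep.IsIrreducible →
            ∀ S₀ : Finset ℕ, 2 ∈ S₀ → (0 : ℕ) ∉ S₀ → Hyp K 2 σ S₀ → Concl K 2 ι σ S₀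

/-- R″ ⇒ its `p = 2`, `2`-split instance (specialisation). -/
theorem splitTwo_of_crux (h : ArtinWeightRealisationEven) : ArtinWeightRealisationEvenSplitTwo :=
  fun ι ρ hirr hA5 heven K _ _ htc hdeg _ σ hmodel hfin hirrσ S₀ hp h0 hyp =>
    h 2 ι ρ hirr hA5 heven K htc hdeg σ hmodel hfin hirrσ S₀ hp h0 hyp

/-- **The deciding theorem goes through with the `p = 2`, `2`-split instance in place of R″**
(proof = the route's `closes` verbatim, threading `hsplit`).  Consequence for the planner: narrowing
R″ to `ArtinWeightRealisationEvenSplitTwo` is free; the `∀ p` / all-`K` generality of the crux is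
unconsumed overshoot. -/
theorem closes_of_splitTwo (hQD : QuadraticDescentGL2) (hQBC : QuadraticBaseChangeGL2)
    (hE1 : ResidualBianchiDoorLevelBC) (hE2 : TwoAdicBianchiProModularityLevel)
    (hR : ArtinWeightRealisationEvenSplitTwo) (hD : IcosahedralDescentLevelBC)
    (hJ : EvenArtinJunction) : _root_.Langlands := by
  suffices hT : EvenIcosahedralStrongArtin from hJ hT
  intro ρ hirr hA5 heven
  have hQ2 : Cardinal.mk ℚ_[2] = Cardinal.continuum := by
    apply le_antisymm
    · change Cardinal.mk (Quotient (CauSeq.equiv : Setoid (CauSeq ℚ (padicNorm 2)))) ≤ Cardinal.continuum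
      refine (Cardinal.mk_quotient_le (s := (CauSeq.equiv : Setoid (CauSeq ℚ (padicNorm 2))))).trans ?_
      refine (Cardinal.mk_subtype_le _).trans_eq ?_
      rw [← Cardinal.power_def, Cardinal.mk_nat, Cardinal.mkRat, Cardinal.aleph0_power_aleph0]
    · exact continuum_le_cardinal_of_nontriviallyNormedField ℚ_[2]
  have hC2 : Cardinal.mk (PadicAlgCl 2) = Cardinal.continuum := by
    apply le_antisymm
    · refine (Algebra.IsAlgebraic.cardinalMk_le_max ℚ_[2] (PadicAlgCl 2)).trans ?_
      rw [hQ2, max_eq_left Cardinal.aleph0_le_continuum]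
    · rw [← hQ2]
      exact Cardinal.mk_le_of_injective (algebraMap ℚ_[2] (PadicAlgCl 2)).injective
  obtain ⟨ι⟩ : Nonempty (PadicAlgCl 2 ≃+* ℂ) := by
    refine IsAlgClosed.ringEquiv_of_equiv_of_charZero ?_
      (Cardinal.eq.1 (by rw [hC2, Cardinal.mk_complex]))
    rw [hC2]
    exact Cardinal.aleph0_lt_continuum
  obtain ⟨S₀, h2, h0, hK⟩ := hE1 hQBC ι ρ hirr hA5
  refine hD hQD hQBC ι ρ hirr hA5 ⟨S₀, h0, ?_⟩
  intro K _ _ htc hdeg hsplit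
  obtain ⟨σ, hmodel, hfin, hirrσ, hA5σ, hcpt, π₀, hRA, hgood⟩ := hK K htc hdeg hsplit
  obtain ⟨hcpt', π, hπ⟩ := hR ι ρ hirr hA5 heven K htc hdeg hsplit σ hmodel hfin hirrσ S₀ h2 h0
    (hE2 K htc hdeg hsplit ι σ hfin hirrσ hA5σ S₀ h2 ⟨hcpt, π₀, hRA, hgood⟩)
  exact ⟨σ, hcpt', π, hmodel, hπ⟩

/-! ## §d TARGETS (pre-line).  No line is picked and `stuck_stubs = []`; but the one crux idea on
file (`Ideas/adjoint-unitary-host-sign-pinning.md`, ideator 2 r1) ships a Lean "first lemma"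
`AdjointPinning.QuadraticTwistPinning` (`Cruxes/ArtinWeightRealisationEven/SketchIdeator2.lean`)
which RE-ADMITS THE ZERO SECTOR: its bad set is `∀ S₀ : Finset ℕ` with no `0 ∉ S₀`.  Recorded here so
that the bug does not propagate into a skeleton. -/

/-- Verbatim copy of `Summit.Langlands.Langlands.Cruxes.ArtinWeightRealisationEven.AdjointPinning.
QuadraticTwistPinning` (ideator 2, round 1; restated because `Cruxes` modules are not built on the
farm and cannot be imported): "`r` agrees with `σ` at every good place up to the sign of the trace ⇒
`r` is conjugate to a quadratic twist of `σ`". -/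
def QuadraticTwistPinning : Prop :=
  ∀ (K : Type) [Field K] [NumberField K] (p : ℕ) [Fact p.Prime]
    (σ r : FramedGaloisRep K (PadicAlgCl p) 2),
    Finite σ.toMonoidHom.range → σ.toGaloisRep.IsIrreducible →
    Nonempty ((Matrix.ProjGenLinGroup.mk.comp σ.toMonoidHom).range ≃* alternatingGroup (Fin 5)) →
    ∀ S₀ : Finset ℕ,
    (∀ v : HeightOneSpectrum (𝓞 K), (∀ ℓ ∈ S₀, ((ℓ : ℕ) : 𝓞 K) ∉ v.asIdeal) →
        σ.IsUnramifiedAt v ∧ r.IsUnramifiedAt v ∧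
        ∃ P : Polynomial (PadicAlgCl p), σ.HasFrobCharpolyAt v P ∧
          (r.HasFrobCharpolyAt v P ∨ r.HasFrobCharpolyAt v (P.comp (-Polynomial.X)))) →
    ∃ (χ : Field.absoluteGaloisGroup K →* (PadicAlgCl p)ˣ) (M : GL (Fin 2) (PadicAlgCl p)),
      (∀ g, χ g ^ 2 = 1) ∧
      ∀ g : Field.absoluteGaloisGroup K,
        ((r g : GL (Fin 2) (PadicAlgCl p)) : Matrix (Fin 2) (Fin 2) (PadicAlgCl p)) =
          ((χ g : (PadicAlgCl p)ˣ) : PadicAlgCl p) •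
            ((M * σ g * M⁻¹ : GL (Fin 2) (PadicAlgCl p)) : Matrix (Fin 2) (Fin 2) (PadicAlgCl p))

/-- **`QuadraticTwistPinning` as sketched refutes its own input.**  Feed it `S₀ = {0}` (no good
place: the compatibility hypothesis is vacuous) and the TRIVIAL representation `r = 1`: it returns
`1 = χ(g) · M σ(g) M⁻¹`, so every `σ(g)` is the scalar `χ(g)⁻¹`, hence central, hence has trivial
image in `PGL₂` — contradicting projective image `A₅`.  So the sketch lemma implies that NO number
field carries a finite-image irreducible `σ : Γ_K → GL₂(ℚ̄_p)` with projective image `A₅`, i.e. it is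
FALSE modulo the (true, unconstructible) existence of one icosahedral `σ` (`stub-misstated`).  REPAIR:
add `(0 : ℕ) ∉ S₀ →` (as in R″ itself), or state the hypothesis place-free ("at every `v` where `σ` and
`r` are unramified"); the zero sector is the only junk found — the repaired lemma is paper-plausible
(`tr r = ±tr σ` pointwise by Chebotarev + continuity ⇒ `Sym² r ≅ Sym² σ`, `det r = det σ` ⇒ projective
images agree ⇒ `r ≅ σ ⊗ χ`, `χ² = 1`). [folklore] -/
theorem false_of_quadraticTwistPinning (hQ : QuadraticTwistPinning) (K : Type) [Field K]
    [NumberField K] (p : ℕ) [Fact p.Prime] (σ : FramedGaloisRep K (PadicAlgCl p) 2)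
    (hfin : Finite σ.toMonoidHom.range) (hirr : σ.toGaloisRep.IsIrreducible)
    (hA5 : Nonempty ((Matrix.ProjGenLinGroup.mk.comp σ.toMonoidHom).range ≃* alternatingGroup (Fin 5))) :
    False := by
  let r : FramedGaloisRep K (PadicAlgCl p) 2 :=
    { toMonoidHom := 1, continuous_toFun := continuous_const }
  have hr : ∀ g, r g = 1 := fun g => rfl
  obtain ⟨χ, M, -, hM⟩ := hQ K p σ r hfin hirr hA5 {0}
    (fun v hv => absurd (hv 0 (by simp)) (by simp))
  -- every `σ g` is the scalar `χ(g)⁻¹`, hence central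
  have hval : ∀ g, ((σ g : GL (Fin 2) (PadicAlgCl p)) : Matrix (Fin 2) (Fin 2) (PadicAlgCl p)) =
      (((χ g)⁻¹ : (PadicAlgCl p)ˣ) : PadicAlgCl p) • (1 : Matrix (Fin 2) (Fin 2) (PadicAlgCl p)) := by
    intro g
    have h1 := hM g
    rw [hr g] at h1
    have h2 : ((M * σ g * M⁻¹ : GL (Fin 2) (PadicAlgCl p)) : Matrix (Fin 2) (Fin 2) (PadicAlgCl p)) =
        (((χ g)⁻¹ : (PadicAlgCl p)ˣ) : PadicAlgCl p) • (1 : Matrix (Fin 2) (Fin 2) (PadicAlgCl p)) := by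
      rw [Units.val_one] at h1
      rw [h1, smul_smul, Units.inv_mul, one_smul]
    have h3 : σ g = M⁻¹ * (M * σ g * M⁻¹) * M := by group
    rw [h3, Units.val_mul, Units.val_mul, h2, Matrix.mul_smul, Matrix.mul_one, Matrix.smul_mul,
      ← Units.val_mul, inv_mul_cancel, Units.val_one]
  have hcent : ∀ g, σ g ∈ Subgroup.center (GL (Fin 2) (PadicAlgCl p)) := by
    intro g
    rw [Subgroup.mem_center_iff]
    intro h
    apply Units.ext
    rw [Units.val_mul, Units.val_mul, hval g, Matrix.mul_smul, Matrix.mul_one, Matrix.smul_mul,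
      Matrix.one_mul]
  -- but the projective image is `A₅`, non-trivial
  obtain ⟨e⟩ := hA5
  haveI : Nontrivial ((Matrix.ProjGenLinGroup.mk.comp σ.toMonoidHom).range) :=
    e.symm.injective.nontrivial
  obtain ⟨x, hx⟩ := exists_ne (1 : (Matrix.ProjGenLinGroup.mk.comp σ.toMonoidHom).range)
  obtain ⟨g, hg⟩ := MonoidHom.mem_range.1 x.2
  apply hx
  apply Subtype.ext
  rw [← hg, Subgroup.coe_one, MonoidHom.comp_apply, Matrix.ProjGenLinGroup.mk_eq_one]
  exact hcent g

/-- Corollary: **`QuadraticTwistPinning` is false modulo the existence of ONE icosahedral `σ`**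
over some number field with values in some `ℚ̄_p` (true — any `A₅`-extension and Klein's
icosahedral representation; not constructible in the tree). -/
theorem not_quadraticTwistPinning_of_exists_icosahedral
    (hex : ∃ (K : Type) (_ : Field K) (_ : NumberField K) (p : ℕ) (_ : Fact p.Prime)
      (σ : FramedGaloisRep K (PadicAlgCl p) 2),
      Finite σ.toMonoidHom.range ∧ σ.toGaloisRep.IsIrreducible ∧
        Nonempty ((Matrix.ProjGenLinGroup.mk.comp σ.toMonoidHom).range ≃* alternatingGroup (Fin 5))) :
    ¬ QuadraticTwistPinning := by
  obtain ⟨K, _, _, p, _, σ, hfin, hirr, hA5⟩ := hex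
  exact fun hQ => false_of_quadraticTwistPinning hQ K p σ hfin hirr hA5

end Summit.Langlands.Langlands.Cruxes.ArtinWeightRealisationEven.Disproof
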